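import Summits.HodgeConjecture.HodgeConjecture.Theorems.F0P3cStCharTSCayleyChartHaar      -- ★ (C4): level kit `valBound_of_mem_level_zero`, `level_antitone`, `isOpen_level`, `isCompact_level`, `exists_level_subset_of_mem_nhds`, `rho_chart_eq_cayleyGL`
import Summits.HodgeConjecture.HodgeConjecture.Theorems.F0P3cStCharTSTubeMeasureChart      -- ★ (C8a): `tube_measure_eq`
import Literature.NumberTheory.Weil1982.CayleyTwistedSandwich                              -- ★ (C5): `cayley_twisted_triple`, `valBound_twisted_incr_of_sandwich`, `valBound_twistedSandwich`, `valBound_cayleySandwich_incr_both`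
import HarnessLib

/-!
# F0 · P3c · line LH6 «StCharTS» — WIF antecedent, ELLIPTIC half: brick (C8b-core) «THE TWISTED TUBE IN THE CAYLEY CHART» — sub-box, the filtered
# Newton hypothesis `(N_L)` for the tube map `Θ`, the pointwise tube identity `c(X)·t₀·c(Y)·c(X)⁻¹ = t₀·c(Θ(X ⊕ Y))`, and the tube measure

Cell `pub/hodgecm-mathlib`, crux H413 = `stmt-HodgeConjecture-24833` (lane `--supports … --as helper`); seat LH5-p02 (g6); ROAD «JAC-ELL» v1 §2 steps (3)–(4)
(+ the sub-box of (Q10)), in ★ (C4)'s ABSTRACT frame so that the model `𝔲(J) ⊃ 𝔱 ⊕ 𝔪` (Q8, F0P3-p04) only has to supply its projections and linear part.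
THEOREMS ONLY; Mathlib + ★ (C4) + ★ (C5) + ★ (C8a).

SETTING.  ★ (C4)'s frame: `ι : V →+ M_m(K)` a closed embedding, levels `hΛ : X ∈ Λ j ↔ ValBound (α^(j+1)) (ι X)` (`0 ≠ α < 1`), `ρ : G →* GL_m(K)` injective,
a chart `c : V → G` with `hc : ρ (c X) = cayley (ι X)` on `Λ 0`.  NEW DATA (all by hypothesis): complementary additive projections `pM pT : V →+ V`
(`pM Z + pT Z = Z`; on the road `pr_𝔪`, `pr_𝔱` of Q8), an element `t₀ : G` with `T := ρ t₀`, `T⁻¹` INTEGRAL (★ `GLn.exists_conj_mem_glInt_of_isCompact` makes the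
compact Cartan integral), a continuous additive automorphism `L : V ≃ₜ+ V` with `ι (L Z) = T⁻¹·ι(pM Z)·T − ι(pM Z) + ι(pT Z)` (Q8's `L̃`), and the TUBE MAP
`Θ : V → V` with `ι (Θ Z) = S(T⁻¹ ι(pM Z) T, S(ι(pT Z), −ι(pM Z)))` on the sub-box (`S` = ★ C2's sandwich; existence of such `Θ` is a range statement the model
proves with ★ Q3).  The SUB-BOX is `Λ′ j := {Z | pM Z ∈ Λ j ∧ pT Z ∈ Λ j}` (constructed here), and the DEPTH `k` is any index with the two UNIFORM SHIFTS
`Λ (j + k) ⊆ Λ′ j` and `pM (L⁻¹ Z), pT (L⁻¹ Z) ∈ Λ j` for `Z ∈ Λ (j + k)` (★ Q11 `exists_uniform_level_shift₂` supplies them).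

THE RESULTS (all PROVED).
* §1 `exists_subBox`, `subBox_le`, `le_subBox`, `subBox_antitone`, `isOpen_subBox`, `isCompact_subBox`, `subBox_basis`.
* §2 **`twisted_newton`** — `(N_L)`: `Θ (x + y) − Θ x − L y ∈ L '' Λ′ (j + 1)` for `x ∈ Λ′ k`, `y ∈ Λ′ j`, `j ≥ k` (★ C5 `valBound_twisted_incr_of_sandwich` read through
  `ι`, then the shift hypotheses); `twisted_mem_level` (`Θ '' Λ′ k ⊆ Λ k`); `symm_twisted_zero_mem` (`L⁻¹ (Θ 0) ∈ Λ′ k`).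
* §3 **`tube_eq_mul_chart_twisted`** — `c (pM Z) * t₀ * c (pT Z) * (c (pM Z))⁻¹ = t₀ * c (Θ Z)` for `Z ∈ Λ′ k` (★ C5 `cayley_twisted_triple`, injectivity of `ρ`).
* §4 **`tube_measure_eq_twisted`** — `κ · ν (t₀ • c '' (Θ '' A)) = addEquivAddHaarChar L · μ A` for `A ⊆ Λ′ k` (★ C8a with `hchart : κ · ν (c '' B) = μ B` on `Λ 0`).

HONEST LABEL: HC_CM is proved only modulo the 7 printed citations (2 remaining named inputs: hLiu418 = `stmt-HodgeConjecture-24832`, h413 =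
`stmt-HodgeConjecture-24833`) until rung 0 closes; this file closes no organ (count-neutral bank for the elliptic half of the WIF antecedent of RUNG0).

## References
* [HarishChandra1970] Harish-Chandra (notes by G. van Dijk), *Harmonic Analysis on Reductive p-adic Groups*, LNM 162 (1970), Lemma 22. Context locator.
* [Serre1992LALG] J.-P. Serre, *Lie Algebras and Lie Groups*, LNM 1500 (1992), Part II Ch. IV §8–§9. Context locator.
-/

set_option autoImplicit false
set_option linter.dupNamespace false

open Set Filter MeasureTheory MeasureTheory.Measure TopologicalSpace Topology Matrix ValuativeRel
open Literature.NumberTheory.Automorphic Literature.NumberTheory.Weil1982.UnitaryFinTopForm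
open Summit.HodgeConjecture.HodgeConjecture.Cruxes.H413.F0P3cStCharTSCayleyChartHaar
open Summit.HodgeConjecture.HodgeConjecture.Cruxes.H413.F0P3cStCharTSTubeMeasureChart
open scoped Pointwise Topology ENNReal MatrixGroups

namespace Summit.HodgeConjecture.HodgeConjecture.Cruxes.H413.F0P3cStCharTSTwistedTubeCore

/-! ## §1 The sub-box `Λ′ j = {Z | pM Z ∈ Λ j ∧ pT Z ∈ Λ j}` -/

section SubBox

variable {K : Type*} [Field K] [ValuativeRel K] {m : Type*} {V : Type*} [AddCommGroup V]
  (ι : V →+ Matrix m m K) (Λ : ℕ → AddSubgroup V) {α : ValueGroupWithZero K} (pM pT : V →+ V)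

/-- The sub-box levels exist as additive subgroups (no definition introduced). [cite: Serre1992LALG, Part II Ch. IV §9] -/
theorem exists_subBox : ∃ Λ' : ℕ → AddSubgroup V, ∀ j Z, Z ∈ Λ' j ↔ (pM Z ∈ Λ j ∧ pT Z ∈ Λ j) := by
  refine ⟨fun j => { carrier := {Z | pM Z ∈ Λ j ∧ pT Z ∈ Λ j}, add_mem' := ?_, zero_mem' := ?_, neg_mem' := ?_ }, fun j Z => Iff.rfl⟩
  · intro a b ha hb
    simp only [Set.mem_setOf_eq, map_add] at ha hb ⊢
    exact ⟨add_mem ha.1 hb.1, add_mem ha.2 hb.2⟩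
  · simp only [Set.mem_setOf_eq, map_zero]; exact ⟨zero_mem _, zero_mem _⟩
  · intro a ha
    simp only [Set.mem_setOf_eq, map_neg] at ha ⊢
    exact ⟨neg_mem ha.1, neg_mem ha.2⟩

variable {Λ pM pT} {Λ' : ℕ → AddSubgroup V}

/-- `Λ′ j ≤ Λ j` (since `Z = pM Z + pT Z`). [cite: Serre1992LALG, Part II Ch. IV §9] -/
theorem subBox_le (hΛ' : ∀ j Z, Z ∈ Λ' j ↔ (pM Z ∈ Λ j ∧ pT Z ∈ Λ j)) (hsum : ∀ Z, pM Z + pT Z = Z) (j : ℕ) : Λ' j ≤ Λ j := by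
  intro Z hZ
  obtain ⟨h1, h2⟩ := (hΛ' j Z).1 hZ
  rw [← hsum Z]
  exact add_mem h1 h2

/-- `Λ (j + k) ≤ Λ′ j` under the uniform shift of the projections. [cite: Serre1992LALG, Part II Ch. IV §9] -/
theorem le_subBox (hΛ' : ∀ j Z, Z ∈ Λ' j ↔ (pM Z ∈ Λ j ∧ pT Z ∈ Λ j)) {k : ℕ}
    (hshift : ∀ j, ∀ Z ∈ Λ (j + k), pM Z ∈ Λ j ∧ pT Z ∈ Λ j) (j : ℕ) : Λ (j + k) ≤ Λ' j :=
  fun Z hZ => (hΛ' j Z).2 (hshift j Z hZ)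

/-- The sub-box levels decrease. [cite: Serre1992LALG, Part II Ch. IV §9] -/
theorem subBox_antitone (hΛ' : ∀ j Z, Z ∈ Λ' j ↔ (pM Z ∈ Λ j ∧ pT Z ∈ Λ j)) (hanti : Antitone Λ) : Antitone Λ' := by
  intro i j hij Z hZ
  rw [hΛ'] at hZ ⊢
  exact ⟨hanti hij hZ.1, hanti hij hZ.2⟩

variable [TopologicalSpace V]

/-- The sub-box levels are open (they contain the open subgroup `Λ (j + k)`). [cite: Serre1992LALG, Part II Ch. IV §9] -/
theorem isOpen_subBox [IsTopologicalAddGroup V] (hΛ' : ∀ j Z, Z ∈ Λ' j ↔ (pM Z ∈ Λ j ∧ pT Z ∈ Λ j)) (hopen : ∀ j, IsOpen (Λ j : Set V)) {k : ℕ}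
    (hshift : ∀ j, ∀ Z ∈ Λ (j + k), pM Z ∈ Λ j ∧ pT Z ∈ Λ j) (j : ℕ) : IsOpen (Λ' j : Set V) :=
  AddSubgroup.isOpen_mono (le_subBox hΛ' hshift j) (hopen (j + k))

/-- The sub-box levels are compact (closed subgroups of the compact `Λ j`). [cite: Serre1992LALG, Part II Ch. IV §9] -/
theorem isCompact_subBox [IsTopologicalAddGroup V] (hΛ' : ∀ j Z, Z ∈ Λ' j ↔ (pM Z ∈ Λ j ∧ pT Z ∈ Λ j)) (hopen : ∀ j, IsOpen (Λ j : Set V))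
    (hcomp : ∀ j, IsCompact (Λ j : Set V)) {k : ℕ} (hshift : ∀ j, ∀ Z ∈ Λ (j + k), pM Z ∈ Λ j ∧ pT Z ∈ Λ j)
    (hsum : ∀ Z, pM Z + pT Z = Z) (j : ℕ) : IsCompact (Λ' j : Set V) :=
  (hcomp j).of_isClosed_subset ((Λ' j).isClosed_of_isOpen (isOpen_subBox hΛ' hopen hshift j)) (subBox_le hΛ' hsum j)

omit [TopologicalSpace V] in
/-- The sub-box levels are a neighbourhood basis of `0` (`Λ′ j ≤ Λ j`). [cite: Serre1992LALG, Part II Ch. IV §9] -/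
theorem subBox_basis [TopologicalSpace V] (hΛ' : ∀ j Z, Z ∈ Λ' j ↔ (pM Z ∈ Λ j ∧ pT Z ∈ Λ j)) (hsum : ∀ Z, pM Z + pT Z = Z)
    (hbasis : ∀ U ∈ 𝓝 (0 : V), ∃ j, (Λ j : Set V) ⊆ U) : ∀ U ∈ 𝓝 (0 : V), ∃ j, (Λ' j : Set V) ⊆ U := by
  intro U hU
  obtain ⟨j, hj⟩ := hbasis U hU
  exact ⟨j, fun Z hZ => hj (subBox_le hΛ' hsum j hZ)⟩

end SubBox

/-! ## §2 The filtered Newton hypothesis `(N_L)` for the twisted tube map -/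

section Newton

variable {K : Type*} [Field K] [ValuativeRel K] {m : Type*} [Fintype m] [DecidableEq m]
  {V : Type*} [AddCommGroup V] [TopologicalSpace V]
  (ι : V →+ Matrix m m K) (Λ : ℕ → AddSubgroup V) {α : ValueGroupWithZero K} (pM pT : V →+ V) {Λ' : ℕ → AddSubgroup V}
  (L : V ≃ₜ+ V) (Θ : V → V) {T Tinv : Matrix m m K} {k : ℕ}

omit [Fintype m] [DecidableEq m] [TopologicalSpace V] in
/-- Membership in a level is an entrywise bound on `ι`. [cite: Serre1992LALG, Part II Ch. IV §9] -/
theorem valBound_of_mem_level (hΛ : ∀ j X, X ∈ Λ j ↔ ValBound (α ^ (j + 1)) (ι X)) {j : ℕ} {X : V} (hX : X ∈ Λ j) :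
    ValBound (α ^ (j + 1)) (ι X) := (hΛ j X).1 hX

/-- **`(N_L)` FOR THE TUBE MAP**: `Θ (x + y) − Θ x − L y ∈ L '' Λ′ (j + 1)` for `x ∈ Λ′ k`, `y ∈ Λ′ j`, `j ≥ k`, provided the base depth `k` absorbs the uniform
shift of `pM ∘ L⁻¹`, `pT ∘ L⁻¹` (`hshiftL`). [cite: HarishChandra1970, Lemma 22] [cite: Serre1992LALG, Part II Ch. IV §8] -/
theorem twisted_newton (hΛ : ∀ j X, X ∈ Λ j ↔ ValBound (α ^ (j + 1)) (ι X)) (hα1 : α < 1)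
    (hΛ' : ∀ j Z, Z ∈ Λ' j ↔ (pM Z ∈ Λ j ∧ pT Z ∈ Λ j))
    (hT1 : ValBound 1 T) (hTinv1 : ValBound 1 Tinv)
    (hL : ∀ Z, ι (L Z) = Tinv * ι (pM Z) * T - ι (pM Z) + ι (pT Z))
    (hΘ : ∀ Z ∈ Λ' k, ι (Θ Z) =
      (fun W X : Matrix m m K => (1 - W)⁻¹ * (W + X) * (1 + W * X)⁻¹ * (1 - W)) (Tinv * ι (pM Z) * T)
        ((fun W X : Matrix m m K => (1 - W)⁻¹ * (W + X) * (1 + W * X)⁻¹ * (1 - W)) (ι (pT Z)) (-ι (pM Z))))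
    (hshiftL : ∀ j, ∀ Z ∈ Λ (j + k), pM (L.symm Z) ∈ Λ j ∧ pT (L.symm Z) ∈ Λ j) :
    ∀ j, k ≤ j → ∀ x ∈ Λ' k, ∀ y ∈ Λ' j, Θ (x + y) - Θ x - L y ∈ L '' (Λ' (j + 1) : Set V) := by
  intro j hj x hx y hy
  have hanti' : Antitone Λ' := subBox_antitone hΛ' (level_antitone ι Λ hΛ hα1.le)
  have hxy : x + y ∈ Λ' k := add_mem hx (hanti' hj hy)
  obtain ⟨hxM, hxT⟩ := (hΛ' k x).1 hx
  obtain ⟨hyM, hyT⟩ := (hΛ' j y).1 hy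
  -- the bounds: `ρ = α^(k+1)`, `γ = α^(j+1)`
  have hρ : α ^ (k + 1) < 1 := pow_lt_one₀ zero_le hα1 (Nat.succ_ne_zero k)
  have hγ : α ^ (j + 1) ≤ α ^ (k + 1) := pow_le_pow_right_of_le_one' hα1.le (by omega)
  -- ★ C5 through `ι`
  have key := valBound_twisted_incr_of_sandwich (fun W X : Matrix m m K => (1 - W)⁻¹ * (W + X) * (1 + W * X)⁻¹ * (1 - W)) hρ hγ
    (fun hW hX => by simpa only [max_self] using valBound_cayleySandwich hW hX hρ hρ)
    (fun hW hX hD hE hδ hε => valBound_cayleySandwich_incr_both hW hX hD hE hρ hδ hε) hT1 hTinv1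
    (valBound_of_mem_level ι Λ hΛ hxM) (valBound_of_mem_level ι Λ hΛ hxT) (valBound_of_mem_level ι Λ hΛ hyM) (valBound_of_mem_level ι Λ hΛ hyT)
  -- the same element, read in `V`
  have hιE : ι (Θ (x + y) - Θ x - L y)
      = (fun W X : Matrix m m K => (1 - W)⁻¹ * (W + X) * (1 + W * X)⁻¹ * (1 - W)) (Tinv * (ι (pM x) + ι (pM y)) * T)
        ((fun W X : Matrix m m K => (1 - W)⁻¹ * (W + X) * (1 + W * X)⁻¹ * (1 - W)) (ι (pT x) + ι (pT y)) (-(ι (pM x) + ι (pM y))))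
      - (fun W X : Matrix m m K => (1 - W)⁻¹ * (W + X) * (1 + W * X)⁻¹ * (1 - W)) (Tinv * ι (pM x) * T)
        ((fun W X : Matrix m m K => (1 - W)⁻¹ * (W + X) * (1 + W * X)⁻¹ * (1 - W)) (ι (pT x)) (-ι (pM x)))
      - (Tinv * ι (pM y) * T - ι (pM y) + ι (pT y)) := by
    rw [map_sub, map_sub, hΘ _ hxy, hΘ _ hx, hL y, map_add, map_add, map_add, map_add]
  have hEmem : Θ (x + y) - Θ x - L y ∈ Λ (j + 1 + k) := by
    refine (hΛ _ _).2 ?_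
    rw [hιE, show j + 1 + k + 1 = (k + 1) + (j + 1) by omega, pow_add]
    exact key
  obtain ⟨h1, h2⟩ := hshiftL (j + 1) _ hEmem
  exact ⟨L.symm (Θ (x + y) - Θ x - L y), (hΛ' _ _).2 ⟨h1, h2⟩, L.apply_symm_apply _⟩

omit [TopologicalSpace V] in
/-- The tube map lands in the level `Λ k` (★ C5 `valBound_twistedSandwich`). [cite: Serre1992LALG, Part II Ch. IV §8] -/
theorem twisted_mem_level (hΛ : ∀ j X, X ∈ Λ j ↔ ValBound (α ^ (j + 1)) (ι X)) (hα1 : α < 1)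
    (hΛ' : ∀ j Z, Z ∈ Λ' j ↔ (pM Z ∈ Λ j ∧ pT Z ∈ Λ j)) (hT1 : ValBound 1 T) (hTinv1 : ValBound 1 Tinv)
    (hΘ : ∀ Z ∈ Λ' k, ι (Θ Z) =
      (fun W X : Matrix m m K => (1 - W)⁻¹ * (W + X) * (1 + W * X)⁻¹ * (1 - W)) (Tinv * ι (pM Z) * T)
        ((fun W X : Matrix m m K => (1 - W)⁻¹ * (W + X) * (1 + W * X)⁻¹ * (1 - W)) (ι (pT Z)) (-ι (pM Z)))) :
    ∀ Z ∈ Λ' k, Θ Z ∈ Λ k := by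
  intro Z hZ
  obtain ⟨hM, hT⟩ := (hΛ' k Z).1 hZ
  have hρ : α ^ (k + 1) < 1 := pow_lt_one₀ zero_le hα1 (Nat.succ_ne_zero k)
  rw [hΛ, hΘ Z hZ]
  exact valBound_twistedSandwich hT1 hTinv1 (valBound_of_mem_level ι Λ hΛ hM) (valBound_of_mem_level ι Λ hΛ hT) hρ

omit [ValuativeRel K] in
/-- `Θ 0 = 0`, hence `L⁻¹ (Θ 0) ∈ Λ′ k` (★ C5 `twistedSandwich_zero`). [cite: Serre1992LALG, Part II Ch. IV §8] -/
theorem symm_twisted_zero_mem (hinj : Function.Injective ι)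
    (hΘ : ∀ Z ∈ Λ' k, ι (Θ Z) =
      (fun W X : Matrix m m K => (1 - W)⁻¹ * (W + X) * (1 + W * X)⁻¹ * (1 - W)) (Tinv * ι (pM Z) * T)
        ((fun W X : Matrix m m K => (1 - W)⁻¹ * (W + X) * (1 + W * X)⁻¹ * (1 - W)) (ι (pT Z)) (-ι (pM Z)))) :
    Θ 0 = 0 ∧ L.symm (Θ 0) ∈ Λ' k := by
  have h0 : Θ 0 = 0 := by
    apply hinj
    rw [hΘ 0 (zero_mem _), map_zero, map_zero, map_zero]
    simp
  refine ⟨h0, ?_⟩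
  rw [h0, map_zero]
  exact zero_mem _

end Newton

/-! ## §3 The pointwise tube identity in `G` -/

section Tube

variable {K : Type*} [Field K] [ValuativeRel K] {m : Type*} [Fintype m] [DecidableEq m]
  {V : Type*} [AddCommGroup V] {G : Type*} [Group G]
  (ι : V →+ Matrix m m K) (Λ : ℕ → AddSubgroup V) {α : ValueGroupWithZero K} (ρ : G →* GL m K) (c : V → G)
  (pM pT : V →+ V) {Λ' : ℕ → AddSubgroup V} (Θ : V → V) (t₀ : G) {k : ℕ}

/-- **THE TUBE IDENTITY**: `c (pM Z) · t₀ · c (pT Z) · (c (pM Z))⁻¹ = t₀ · c (Θ Z)` for `Z ∈ Λ′ k` (★ C5 `cayley_twisted_triple`; `ρ` injective; `T = ρ t₀` integral with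
integral inverse). [cite: HarishChandra1970, Lemma 22] [cite: PlatonovRapinchuk1994, §3.3] -/
theorem tube_eq_mul_chart_twisted (hΛ : ∀ j X, X ∈ Λ j ↔ ValBound (α ^ (j + 1)) (ι X)) (hα1 : α < 1) (hρinj : Function.Injective ρ)
    (hc : ∀ X ∈ Λ 0, ((ρ (c X) : GL m K) : Matrix m m K) = cayley (ι X))
    (hΛ' : ∀ j Z, Z ∈ Λ' j ↔ (pM Z ∈ Λ j ∧ pT Z ∈ Λ j))
    (hT1 : ValBound 1 ((ρ t₀ : GL m K) : Matrix m m K)) (hTinv1 : ValBound 1 (((ρ t₀)⁻¹ : GL m K) : Matrix m m K))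
    (hΘ : ∀ Z ∈ Λ' k, ι (Θ Z) =
      (fun W X : Matrix m m K => (1 - W)⁻¹ * (W + X) * (1 + W * X)⁻¹ * (1 - W)) ((((ρ t₀)⁻¹ : GL m K) : Matrix m m K) * ι (pM Z) * ((ρ t₀ : GL m K) : Matrix m m K))
        ((fun W X : Matrix m m K => (1 - W)⁻¹ * (W + X) * (1 + W * X)⁻¹ * (1 - W)) (ι (pT Z)) (-ι (pM Z))))
    {Z : V} (hZ : Z ∈ Λ' k) :
    c (pM Z) * t₀ * c (pT Z) * (c (pM Z))⁻¹ = t₀ * c (Θ Z) := by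
  have hanti := level_antitone ι Λ hΛ hα1.le
  obtain ⟨hM, hT⟩ := (hΛ' k Z).1 hZ
  have hM0 : pM Z ∈ Λ 0 := hanti (Nat.zero_le k) hM
  have hT0 : pT Z ∈ Λ 0 := hanti (Nat.zero_le k) hT
  have hΘ0 : Θ Z ∈ Λ 0 := hanti (Nat.zero_le k)
    (twisted_mem_level ι Λ pM pT Θ hΛ hα1 hΛ' hT1 hTinv1 hΘ Z hZ)
  have hρ' : α ^ (k + 1) < 1 := pow_lt_one₀ zero_le hα1 (Nat.succ_ne_zero k)
  -- read everything in `GL m K`, then in matrices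
  apply hρinj
  apply Units.ext
  have hinvW : ((ρ (c (pM Z))⁻¹ : GL m K) : Matrix m m K) = cayley (-ι (pM Z)) := by
    rw [map_inv, rho_chart_eq_cayleyGL ι Λ ρ c hΛ hα1 hc hM0, coe_cayleyGL_inv]
  simp only [map_mul, Units.val_mul]
  rw [hinvW, hc _ hM0, hc _ hT0, hc _ hΘ0, hΘ Z hZ]
  have hTT : ((ρ t₀ : GL m K) : Matrix m m K) * (((ρ t₀)⁻¹ : GL m K) : Matrix m m K) = 1 := by
    rw [← Units.val_mul, mul_inv_cancel, Units.val_one]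
  have hTT' : (((ρ t₀)⁻¹ : GL m K) : Matrix m m K) * ((ρ t₀ : GL m K) : Matrix m m K) = 1 := by
    rw [← Units.val_mul, inv_mul_cancel, Units.val_one]
  have key := cayley_twisted_triple hTT hTT' hT1 hTinv1 (valBound_of_mem_level ι Λ hΛ hM) (valBound_of_mem_level ι Λ hΛ hT) hρ'
  -- `c(X) T c(Y) c(−X) = T · (T⁻¹ c(X) T c(Y) c(−X))`
  calc cayley (ι (pM Z)) * ((ρ t₀ : GL m K) : Matrix m m K) * cayley (ι (pT Z)) * cayley (-ι (pM Z))
      = ((ρ t₀ : GL m K) : Matrix m m K) * ((((ρ t₀)⁻¹ : GL m K) : Matrix m m K) * cayley (ι (pM Z)) * ((ρ t₀ : GL m K) : Matrix m m K)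
          * cayley (ι (pT Z)) * cayley (-ι (pM Z))) := by
        rw [show ((ρ t₀ : GL m K) : Matrix m m K) * ((((ρ t₀)⁻¹ : GL m K) : Matrix m m K) * cayley (ι (pM Z)) * ((ρ t₀ : GL m K) : Matrix m m K)
            * cayley (ι (pT Z)) * cayley (-ι (pM Z)))
            = (((ρ t₀ : GL m K) : Matrix m m K) * (((ρ t₀)⁻¹ : GL m K) : Matrix m m K)) * cayley (ι (pM Z)) * ((ρ t₀ : GL m K) : Matrix m m K)
              * cayley (ι (pT Z)) * cayley (-ι (pM Z)) by simp only [Matrix.mul_assoc], hTT, Matrix.one_mul]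
    _ = ((ρ t₀ : GL m K) : Matrix m m K) * cayley _ := by rw [key]

end Tube

/-! ## §4 The tube measure -/

section TubeMeasure

variable {K : Type*} [Field K] [ValuativeRel K] [TopologicalSpace K] [IsNonarchimedeanLocalField K]
  {m : Type*} [Fintype m] [DecidableEq m]
  {V : Type*} [AddCommGroup V] [TopologicalSpace V] [IsTopologicalAddGroup V] [T2Space V] [SecondCountableTopology V]
  [LocallyCompactSpace V] [MeasurableSpace V] [BorelSpace V]
  {G : Type*} [Group G] [MeasurableSpace G]
  (ι : V →+ Matrix m m K) (Λ : ℕ → AddSubgroup V) {α : ValueGroupWithZero K} (c : V → G)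
  (pM pT : V →+ V) {Λ' : ℕ → AddSubgroup V} (L : V ≃ₜ+ V) (Θ : V → V) {T Tinv : Matrix m m K} {k : ℕ}
  (μ : Measure V) [μ.IsAddHaarMeasure] (ν : Measure G) [ν.IsMulLeftInvariant]

/-- **THE TUBE MEASURE**: `κ · ν (t₀ • c '' (Θ '' A)) = addEquivAddHaarChar L · μ A` for `A ⊆ Λ′ k` with Borel images, where `κ · ν (c '' B) = μ B` on `Λ 0`
(★ C4∕C4u) — ★ C8a `tube_measure_eq` fed with §1–§2. [cite: HarishChandra1970, Lemma 22] -/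
theorem tube_measure_eq_twisted (hι : IsClosedEmbedding ι) (hΛ : ∀ j X, X ∈ Λ j ↔ ValBound (α ^ (j + 1)) (ι X)) (hα : α ≠ 0) (hα1 : α < 1)
    (hΛ' : ∀ j Z, Z ∈ Λ' j ↔ (pM Z ∈ Λ j ∧ pT Z ∈ Λ j)) (hsum : ∀ Z, pM Z + pT Z = Z)
    (hshift : ∀ j, ∀ Z ∈ Λ (j + k), pM Z ∈ Λ j ∧ pT Z ∈ Λ j)
    (hT1 : ValBound 1 T) (hTinv1 : ValBound 1 Tinv)
    (hL : ∀ Z, ι (L Z) = Tinv * ι (pM Z) * T - ι (pM Z) + ι (pT Z))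
    (hΘ : ∀ Z ∈ Λ' k, ι (Θ Z) =
      (fun W X : Matrix m m K => (1 - W)⁻¹ * (W + X) * (1 + W * X)⁻¹ * (1 - W)) (Tinv * ι (pM Z) * T)
        ((fun W X : Matrix m m K => (1 - W)⁻¹ * (W + X) * (1 + W * X)⁻¹ * (1 - W)) (ι (pT Z)) (-ι (pM Z))))
    (hΘc : ContinuousOn Θ (Λ' k : Set V))
    (hshiftL : ∀ j, ∀ Z ∈ Λ (j + k), pM (L.symm Z) ∈ Λ j ∧ pT (L.symm Z) ∈ Λ j)
    {κ : ℝ≥0∞} (hchart : ∀ B ⊆ (Λ 0 : Set V), MeasurableSet (c '' B) → κ * ν (c '' B) = μ B)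
    (t₀ : G) {A : Set V} (hA : A ⊆ (Λ' k : Set V)) (hAm : MeasurableSet (Θ '' A)) (hAcm : MeasurableSet (c '' (Θ '' A))) :
    κ * ν (t₀ • (c '' (Θ '' A))) = addEquivAddHaarChar L * μ A := by
  have hanti := level_antitone ι Λ hΛ hα1.le
  have hopenΛ := isOpen_level ι Λ hι.continuous hΛ hα
  have hcompΛ := isCompact_level ι Λ hι hΛ
  refine tube_measure_eq Λ' Θ L μ c ν (subBox_antitone hΛ' hanti) (isOpen_subBox hΛ' hopenΛ hshift)
    (isCompact_subBox hΛ' hopenΛ hcompΛ hshift hsum k)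
    (subBox_basis hΛ' hsum (exists_level_subset_of_mem_nhds ι Λ hι hΛ hα1)) hΘc
    (twisted_newton ι Λ pM pT L Θ hΛ hα1 hΛ' hT1 hTinv1 hL hΘ hshiftL)
    (symm_twisted_zero_mem ι pM pT L Θ hι.injective hΘ).2 (S := (Λ 0 : Set V)) ?_ hchart t₀ hA hAm hAcm
  rintro _ ⟨Z, hZ, rfl⟩
  exact hanti (Nat.zero_le k) (twisted_mem_level ι Λ pM pT Θ hΛ hα1 hΛ' hT1 hTinv1 hΘ Z hZ)

end TubeMeasure

end Summit.HodgeConjecture.HodgeConjecture.Cruxes.H413.F0P3cStCharTSTwistedTubeCore
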